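import Mathlib
import HarnessLib
import Literature.Analysis.FluidPDE.AxisymHouLiVariables
import Summits.NavierStokesRegularity.NavierStokesRegularity.Theorems.PoloidalWindowDoorPoloidalWindowRigidityZShockHeightEvolution

/-!
# Crux K2 `PoloidalWindowRigidity` (stmt-NavierStokesRegularity-19708), line `z_shock` — the WAVE-ENERGY IDENTITY of the autonomous
# height-evolution: the positive hyperbolic energy is conserved in the height iff the window is (TH); on the THICK column its budget
# carries exactly the signed cubic source `−½G'(w) w_z |∇ₕw|²`

`--supports stmt-NavierStokesRegularity-19708 --as helper` (leafhand-ns-poloidalwindowdoor-3 g4, cell decomp-ns, 2026-08-31; companion of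
`…ZShockNoetherLaws`).  **No stub and no summit is closed by this file; Navier–Stokes regularity is NOT proved here (rung 0).**

WHY THIS FILE.  On a connected non-degenerate region of a slice of an autonomous-column class profile the height component `w = v₂` solves
the autonomous quasilinear equation `w_zz + divₕ(G(w)∇ₕw) = 0` (`…ZShockHeightEvolution.heightEvolution_of_slope_function`), a genuine wave
equation `w_zz = divₕ(c²(w)∇ₕw)` with `c² = −G > 0` on the hyperbolic window (`…slope_neg_of_hyperbolic`).  Rung R3 of the card
(`Cruxes/PoloidalWindowRigidity/Lines/z_shock.md` §Hardest stub: two-sided eternal rigidity in `2+1` dimensions) has, besides the exact but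
INDEFINITE Noether energy `Ψ(w) − ½|vₕ|²` (`…ZShockNoetherLaws`), one positive-definite quantity: the wave energy `½w_z² + ½c²(w)|∇ₕw|²`.
This file records its exact local budget, multiplying the height-evolution equation by `w_z`:

* `waveEnergy_identity_of_slope_function` (class-free): `f : ℝ³ → ℝ³` real-analytic and divergence-free, slope law `∂₂f_b = G(f₂)·∂_b f₂`
  (`b = 0, 1`) on an open `U` with `G` differentiable at the values (`G'`) ⇒ at every `x ∈ U`
  `∂₂[½(∂₂f₂)² − ½G(f₂)((∂₀f₂)² + (∂₁f₂)²)] + ∂₀[G(f₂)·∂₂f₂·∂₀f₂] + ∂₁[G(f₂)·∂₂f₂·∂₁f₂] = −½·G'(f₂)·∂₂f₂·((∂₀f₂)² + (∂₁f₂)²)`,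
  i.e. `∂_z[½w_z² + ½c²|∇ₕw|²] − divₕ(c² w_z ∇ₕw) = ½(c²)'(w) w_z|∇ₕw|²`.
* `waveEnergy_identity_of_class_autonomy` (class entry): class binders of `stub_zShockThickAut` + the LOCAL autonomy clause at `z₀ ∈ W₁` ⇒ on
  every open connected `Ω ⊆ {∇ₕv₂(t₀,·) ≠ 0}` of the slice `t₀ = z₀.1` the identity holds with the (analytic) slope function `G` of
  `…ZShockSlopeFunctionConnected` and `G' = deriv G`.

* (appended) `waveEnergy_flux_le` — the pointwise FLUX-DOMINANCE inequality behind finite speed of propagation for this energy: for `G < 0`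
  and a horizontal unit vector `n`, `|G·w_z·(∇ₕw·n)| ≤ √(−G)·(½w_z² − ½G|∇ₕw|²)` (Cauchy–Schwarz + AM–GM; the acoustic speed is `c = √(−G)`).
  With the identity above this is the complete LOCAL ingredient list of the energy method on the thick column (the cubic source is the only
  obstruction to a clean domain-of-dependence estimate, and it is `O(|G'||w_z|)·energy`).

READING (honest, bookkeeping-grade): the source vanishes identically iff `G' = 0` at the values, i.e. exactly on the (TH) column (where every
horizontal Fourier mode rides one linear string and the energy of each is conserved — lines string_shells / entire_slices); THICK = genuine
nonlinearity = `G' ≠ 0` (`…ZShockGenuineNonlinearity`) is precisely the presence of the cubic energy source, of the sign of `−G'(w)·w_z`.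
This is the energy-level expression of «thickness = genuine nonlinearity» and the starting identity of every small-data (almost-conservation /
bootstrap) argument for R3; it proves no rigidity by itself.  presearch: energy identities for `u_tt − div(c²(u)∇u) = 0` are textbook
(e.g. [corpus:book:alinhac2009 pp.44–46, 108]); no tree statement for the height-evolution existed. [folklore]
-/

noncomputable section

namespace Summit.NavierStokesRegularity.NavierStokesRegularity.Theorems.PoloidalWindowDoorPoloidalWindowRigidityZShockWaveEnergy

-- the problem directory repeats the summit name (`NavierStokesRegularity/NavierStokesRegularity`)
set_option linter.dupNamespace false

open Set Filter Topology Function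
open Literature.Analysis Literature.Analysis.FluidPDE
open Summit.NavierStokesRegularity.NavierStokesRegularity.Theorems.PoloidalWindowDoorPoloidalWindowRigidityZShockSlopeFunctionConnected
open Summit.NavierStokesRegularity.NavierStokesRegularity.Theorems.PoloidalWindowDoorPoloidalWindowRigidityZShockHeightEvolution
open Summit.NavierStokesRegularity.NavierStokesRegularity.Theorems.PoloidalWindowDoorPoloidalWindowRigidityHorizontalSourceGauge
  (analyticOnNhd_fderiv_apply_coord)
open Summit.NavierStokesRegularity.NavierStokesRegularity.Theorems.PoloidalWindowDoorPoloidalWindowRigidityZShockAutonomyGlobal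
  (analyticOnNhd_coord)

/-- **The wave-energy identity of the autonomous height-evolution (class-free).**  For a real-analytic divergence-free `f : ℝ³ → ℝ³`
obeying the slope law `∂₂f_b = G(f₂)·∂_b f₂` (`b = 0, 1`) on an open set `U`, with `G` differentiable at the values (`G'`), at every `x ∈ U`:
`∂₂[½(∂₂f₂)² − ½G(f₂)((∂₀f₂)² + (∂₁f₂)²)] + ∂₀[G(f₂)∂₂f₂∂₀f₂] + ∂₁[G(f₂)∂₂f₂∂₁f₂] = −½G'(f₂)∂₂f₂((∂₀f₂)² + (∂₁f₂)²)`. [folklore] -/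
theorem waveEnergy_identity_of_slope_function {f : EuclideanSpace ℝ (Fin 3) → EuclideanSpace ℝ (Fin 3)}
    (hf : AnalyticOnNhd ℝ f univ) (hdiv : VectorCalculus.IsDivFree f) {G G' : ℝ → ℝ}
    {U : Set (EuclideanSpace ℝ (Fin 3))} (hU : IsOpen U)
    (hG : ∀ y ∈ U, HasDerivAt G (G' (f y 2)) (f y 2))
    (hslope : ∀ y ∈ U, ∀ b : Fin 3, b ≠ 2 →
      fderiv ℝ f y (EuclideanSpace.single 2 1) b = G (f y 2) * fderiv ℝ f y (EuclideanSpace.single b 1) 2)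
    {x : EuclideanSpace ℝ (Fin 3)} (hx : x ∈ U) :
    fderiv ℝ (fun y => (1 / 2) * fderiv ℝ f y (EuclideanSpace.single 2 1) 2 ^ 2 -
        (1 / 2) * G (f y 2) * (fderiv ℝ f y (EuclideanSpace.single 0 1) 2 ^ 2 + fderiv ℝ f y (EuclideanSpace.single 1 1) 2 ^ 2)) x
        (EuclideanSpace.single 2 1) +
      fderiv ℝ (fun y => G (f y 2) * fderiv ℝ f y (EuclideanSpace.single 2 1) 2 * fderiv ℝ f y (EuclideanSpace.single 0 1) 2) x
        (EuclideanSpace.single 0 1) +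
      fderiv ℝ (fun y => G (f y 2) * fderiv ℝ f y (EuclideanSpace.single 2 1) 2 * fderiv ℝ f y (EuclideanSpace.single 1 1) 2) x
        (EuclideanSpace.single 1 1) =
      -(1 / 2) * G' (f x 2) * fderiv ℝ f x (EuclideanSpace.single 2 1) 2 *
        (fderiv ℝ f x (EuclideanSpace.single 0 1) 2 ^ 2 + fderiv ℝ f x (EuclideanSpace.single 1 1) 2 ^ 2) := by
  -- smoothness bookkeeping
  have hf2 : ContDiff ℝ 2 f := contDiff_iff_contDiffAt.2 fun y => (hf y (mem_univ _)).contDiffAt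
  have hD : ∀ (u : EuclideanSpace ℝ (Fin 3)) (i : Fin 3), Differentiable ℝ fun y => fderiv ℝ f y u i :=
    fun u i y => (analyticOnNhd_fderiv_apply_coord hf u i y (mem_univ _)).differentiableAt
  have hDv : ∀ u : EuclideanSpace ℝ (Fin 3), Differentiable ℝ fun y => fderiv ℝ f y u := by
    intro u
    have h1 : ContDiff ℝ 1 (fderiv ℝ f) := hf2.fderiv_right (m := 1) (by norm_num)
    exact (h1.differentiable one_ne_zero).clm_apply (differentiable_const u)
  have hw : Differentiable ℝ fun y => f y 2 := fun y => (analyticOnNhd_coord hf 2 y (mem_univ _)).differentiableAt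
  -- notation for the basis vectors
  set e0 : EuclideanSpace ℝ (Fin 3) := EuclideanSpace.single 0 1 with he0
  set e1 : EuclideanSpace ℝ (Fin 3) := EuclideanSpace.single 1 1 with he1
  set e2 : EuclideanSpace ℝ (Fin 3) := EuclideanSpace.single 2 1 with he2
  -- first-derivative fields and their derivatives at `x`
  have hd0 : HasFDerivAt (fun y => fderiv ℝ f y e0 2) (fderiv ℝ (fun y => fderiv ℝ f y e0 2) x) x := (hD e0 2 x).hasFDerivAt
  have hd1 : HasFDerivAt (fun y => fderiv ℝ f y e1 2) (fderiv ℝ (fun y => fderiv ℝ f y e1 2) x) x := (hD e1 2 x).hasFDerivAt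
  have hd2 : HasFDerivAt (fun y => fderiv ℝ f y e2 2) (fderiv ℝ (fun y => fderiv ℝ f y e2 2) x) x := (hD e2 2 x).hasFDerivAt
  have hGc : HasFDerivAt (fun y => G (f y 2)) (G' (f x 2) • fderiv ℝ (fun y => f y 2) x) x :=
    (hG x hx).comp_hasFDerivAt x (hw x).hasFDerivAt
  -- the three differentiated expressions
  have hE : HasFDerivAt (fun y => (1 / 2) * fderiv ℝ f y e2 2 ^ 2 -
      (1 / 2) * G (f y 2) * (fderiv ℝ f y e0 2 ^ 2 + fderiv ℝ f y e1 2 ^ 2)) _ x :=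
    ((hd2.pow 2).const_mul (1 / 2 : ℝ)).sub ((hGc.const_mul (1 / 2 : ℝ)).mul ((hd0.pow 2).add (hd1.pow 2)))
  have hF0 : HasFDerivAt (fun y => G (f y 2) * fderiv ℝ f y e2 2 * fderiv ℝ f y e0 2) _ x := (hGc.mul hd2).mul hd0
  have hF1 : HasFDerivAt (fun y => G (f y 2) * fderiv ℝ f y e2 2 * fderiv ℝ f y e1 2) _ x := (hGc.mul hd2).mul hd1
  rw [hE.fderiv, hF0.fderiv, hF1.fderiv]
  simp only [_root_.sub_apply, _root_.add_apply, _root_.smul_apply, smul_eq_mul, nsmul_eq_mul, Pi.mul_apply]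
  -- `D(f₂)(x) u = ∂_u f₂`
  have hwx : ∀ u : EuclideanSpace ℝ (Fin 3), fderiv ℝ (fun y => f y 2) x u = fderiv ℝ f x u 2 :=
    fun u => fderiv_apply_coord_vec3 (hf x (mem_univ _)).differentiableAt 2 u
  simp only [hwx]
  -- Schwarz: `∂₂(∂_b f₂) = ∂_b(∂₂ f₂)`
  have hschwarz : ∀ eb : EuclideanSpace ℝ (Fin 3),
      fderiv ℝ (fun y => fderiv ℝ f y eb 2) x e2 = fderiv ℝ (fun y => fderiv ℝ f y e2 2) x eb := by
    intro eb
    rw [fderiv_apply_coord_vec3 (w := fun y => fderiv ℝ f y eb) (hDv eb x) 2 e2,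
      fderiv_apply_coord_vec3 (w := fun y => fderiv ℝ f y e2) (hDv e2 x) 2 eb,
      fderiv_fderiv_apply_comm_vec hf2 x eb e2]
  have hS0 := hschwarz e0
  have hS1 := hschwarz e1
  -- the height-evolution equation at `x`
  have hHE := heightEvolution_of_slope_function hf hdiv hU hG hslope hx
  simp only [← he0, ← he1, ← he2] at hHE
  simp only [Nat.cast_ofNat, pow_one, Nat.add_one_sub_one]
  linear_combination fderiv ℝ f x e2 2 * hHE - G (f x 2) * fderiv ℝ f x e0 2 * hS0 -
    G (f x 2) * fderiv ℝ f x e1 2 * hS1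

/-- **The wave-energy identity for the route's class, on every connected non-degenerate region of the slice.**  Class binders of
`stub_zShockThickAut` + the stub's LOCAL autonomy clause at `z₀ ∈ W₁`: on every open connected `Ω ⊆ {∇ₕv₂(t₀,·) ≠ 0}` (`t₀ = z₀.1`) there is ONE
slope function `G`, real-analytic at the values, with the slope law on `Ω`, such that at every `x ∈ Ω`
`∂₂[½(∂₂v₂)² − ½G(v₂)|∇ₕv₂|²] + ∂₀[G(v₂)∂₂v₂∂₀v₂] + ∂₁[G(v₂)∂₂v₂∂₁v₂] = −½·(deriv G)(v₂)·∂₂v₂·|∇ₕv₂|²`. [folklore] -/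
theorem waveEnergy_identity_of_class_autonomy (C : ℝ) (v : ℝ → EuclideanSpace ℝ (Fin 3) → EuclideanSpace ℝ (Fin 3))
    (hrate : Literature.Analysis.FluidPDE.HasTypeITimeDecay C v)
    (hcont : ContinuousOn (Function.uncurry v) (Set.Iio (0 : ℝ) ×ˢ Set.univ))
    (hmild : ∀ s t : ℝ, s < t → t < 0 → ∀ x, v t x =
      Literature.Analysis.UnboundedOperators.heatExtension (v s) (t - s) x -
        Literature.Analysis.FluidPDE.oseenDuhamel 1 s v v t x)
    (hdiv : ∀ t < 0, Literature.Analysis.FluidPDE.VectorCalculus.IsDivFree (v t))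
    (hpol : ∀ s < 0, ∀ y, inner ℝ (Literature.Analysis.FluidPDE.curl (v s) y) (EuclideanSpace.single 2 1) = 0)
    {W₁ : Set (ℝ × EuclideanSpace ℝ (Fin 3))} (hW₁ : IsOpen W₁) (hW₁s : W₁ ⊆ Set.Iio (0 : ℝ) ×ˢ Set.univ)
    {z₀ : ℝ × EuclideanSpace ℝ (Fin 3)} (hz₀ : z₀ ∈ W₁) {g : ℝ → ℝ → ℝ}
    (haut : ∀ z ∈ W₁, ∀ b : Fin 3, b ≠ 2 →
      fderiv ℝ (v z.1) z.2 (EuclideanSpace.single 2 1) b =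
        g z.1 (v z.1 z.2 2) * fderiv ℝ (v z.1) z.2 (EuclideanSpace.single b 1) 2)
    {Ω : Set (EuclideanSpace ℝ (Fin 3))} (hΩ : IsPreconnected Ω) (hΩo : IsOpen Ω)
    (hΩnd : ∀ x ∈ Ω, fderiv ℝ (v z₀.1) x (EuclideanSpace.single 0 1) 2 ≠ 0 ∨
      fderiv ℝ (v z₀.1) x (EuclideanSpace.single 1 1) 2 ≠ 0) :
    ∃ G : ℝ → ℝ, (∀ x ∈ Ω, AnalyticAt ℝ G (v z₀.1 x 2)) ∧
      (∀ x ∈ Ω, ∀ b : Fin 3, b ≠ 2 → fderiv ℝ (v z₀.1) x (EuclideanSpace.single 2 1) b =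
        G (v z₀.1 x 2) * fderiv ℝ (v z₀.1) x (EuclideanSpace.single b 1) 2) ∧
      ∀ x ∈ Ω,
        fderiv ℝ (fun y => (1 / 2) * fderiv ℝ (v z₀.1) y (EuclideanSpace.single 2 1) 2 ^ 2 -
            (1 / 2) * G (v z₀.1 y 2) *
              (fderiv ℝ (v z₀.1) y (EuclideanSpace.single 0 1) 2 ^ 2 + fderiv ℝ (v z₀.1) y (EuclideanSpace.single 1 1) 2 ^ 2)) x
            (EuclideanSpace.single 2 1) +
          fderiv ℝ (fun y => G (v z₀.1 y 2) * fderiv ℝ (v z₀.1) y (EuclideanSpace.single 2 1) 2 *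
              fderiv ℝ (v z₀.1) y (EuclideanSpace.single 0 1) 2) x (EuclideanSpace.single 0 1) +
          fderiv ℝ (fun y => G (v z₀.1 y 2) * fderiv ℝ (v z₀.1) y (EuclideanSpace.single 2 1) 2 *
              fderiv ℝ (v z₀.1) y (EuclideanSpace.single 1 1) 2) x (EuclideanSpace.single 1 1) =
          -(1 / 2) * deriv G (v z₀.1 x 2) * fderiv ℝ (v z₀.1) x (EuclideanSpace.single 2 1) 2 *
            (fderiv ℝ (v z₀.1) x (EuclideanSpace.single 0 1) 2 ^ 2 + fderiv ℝ (v z₀.1) x (EuclideanSpace.single 1 1) 2 ^ 2) := by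
  obtain ⟨G, hGA, hG⟩ := autonomy_on_connected_of_class_autonomy C v hrate hcont hmild hdiv hpol hW₁ hW₁s hz₀ haut hΩ hΩo hΩnd
  have ht₀ : z₀.1 < 0 := (Set.mem_prod.1 (hW₁s hz₀)).1
  have hbdd : ∀ δ : ℝ, 0 < δ → ∃ B : ℝ, ∀ t < -δ, ∀ y : EuclideanSpace ℝ (Fin 3), ‖v t y‖ ≤ B := by
    intro δ hδ
    refine ⟨|C| / Real.sqrt δ, fun t ht y => ?_⟩
    have hδt : δ ≤ -t := by linarith
    have hsq : Real.sqrt δ ≤ Real.sqrt (-t) := Real.sqrt_le_sqrt hδt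
    have hsqpos : 0 < Real.sqrt δ := Real.sqrt_pos.2 hδ
    calc ‖v t y‖ ≤ C / Real.sqrt (-t) := hrate t (by linarith) y
      _ ≤ |C| / Real.sqrt (-t) := by gcongr; exact le_abs_self C
      _ ≤ |C| / Real.sqrt δ := by gcongr
  have han : AnalyticOnNhd ℝ (v z₀.1) univ :=
    Literature.Analysis.NavierStokesZoomKit.LocalSineTubeDoorProfileAlignedWindowRigidityAncient.analyticOnNhd_slice
      hcont hbdd hmild ht₀
  refine ⟨G, hGA, hG, fun x hx => ?_⟩
  exact waveEnergy_identity_of_slope_function han (hdiv z₀.1 ht₀) hΩo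
    (fun y hy => (hGA y hy).differentiableAt.hasDerivAt) hG hx

/-- **Flux dominance (pointwise; the inequality behind finite speed of propagation for the wave energy).**  For `G < 0` (hyperbolic, acoustic
speed `c = √(−G)`), any `w_z, ∂₀w, ∂₁w` and any horizontal unit vector `(n₀, n₁)`:
`|G·w_z·(∂₀w·n₀ + ∂₁w·n₁)| ≤ √(−G)·(½w_z² − ½G((∂₀w)² + (∂₁w)²))` — the normal energy flux `c²w_z ∂ₙw` of `waveEnergy_identity_of_slope_function`
is at most `c` times the (positive) energy density. [folklore] -/
theorem waveEnergy_flux_le {G wz a0 a1 n0 n1 : ℝ} (hG : G < 0) (hn : n0 ^ 2 + n1 ^ 2 = 1) :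
    |G * wz * (a0 * n0 + a1 * n1)| ≤ Real.sqrt (-G) * ((1 / 2) * wz ^ 2 - (1 / 2) * G * (a0 ^ 2 + a1 ^ 2)) := by
  set c : ℝ := Real.sqrt (-G) with hc
  have hc0 : 0 ≤ c := Real.sqrt_nonneg _
  have hc2 : c ^ 2 = -G := Real.sq_sqrt (by linarith)
  set R : ℝ := c * ((1 / 2) * wz ^ 2 - (1 / 2) * G * (a0 ^ 2 + a1 ^ 2)) with hR
  have hA : 0 ≤ a0 ^ 2 + a1 ^ 2 := by positivity
  have hR0 : 0 ≤ R := by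
    have : 0 ≤ (1 / 2) * wz ^ 2 - (1 / 2) * G * (a0 ^ 2 + a1 ^ 2) := by nlinarith [sq_nonneg wz]
    exact mul_nonneg hc0 this
  -- Cauchy–Schwarz with `|n| = 1`
  have hCS : (a0 * n0 + a1 * n1) ^ 2 ≤ a0 ^ 2 + a1 ^ 2 := by
    nlinarith [sq_nonneg (a0 * n1 - a1 * n0)]
  -- compare squares
  have hsq : (G * wz * (a0 * n0 + a1 * n1)) ^ 2 ≤ R ^ 2 := by
    have h1 : (G * wz * (a0 * n0 + a1 * n1)) ^ 2 ≤ G ^ 2 * wz ^ 2 * (a0 ^ 2 + a1 ^ 2) := by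
      have : (G * wz * (a0 * n0 + a1 * n1)) ^ 2 = G ^ 2 * wz ^ 2 * (a0 * n0 + a1 * n1) ^ 2 := by ring
      rw [this]
      exact mul_le_mul_of_nonneg_left hCS (by positivity)
    have h2 : R ^ 2 = (-G) * ((1 / 2) * wz ^ 2 - (1 / 2) * G * (a0 ^ 2 + a1 ^ 2)) ^ 2 := by
      rw [hR, mul_pow, hc2]
    rw [h2]
    -- AM–GM: with `X = wz²`, `Y = −G·(a0²+a1²)`: `G²wz²(a0²+a1²) = (−G)·X·Y ≤ (−G)·((X+Y)/2)²`
    nlinarith [mul_nonneg (neg_nonneg.2 hG.le) (sq_nonneg (wz ^ 2 + G * (a0 ^ 2 + a1 ^ 2))), h1]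
  calc |G * wz * (a0 * n0 + a1 * n1)| = Real.sqrt ((G * wz * (a0 * n0 + a1 * n1)) ^ 2) := (Real.sqrt_sq_eq_abs _).symm
    _ ≤ Real.sqrt (R ^ 2) := Real.sqrt_le_sqrt hsq
    _ = R := Real.sqrt_sq hR0

end Summit.NavierStokesRegularity.NavierStokesRegularity.Theorems.PoloidalWindowDoorPoloidalWindowRigidityZShockWaveEnergy

end
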